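import Literature.AnabelianGeometry.EtaleTheta.LogDivisorModelTateTowerKummerTwistInflate
import Literature.AnabelianGeometry.EtaleTheta.LogDivisorModelTateTowerKummerTwistLevel

/-!
# [EtTh] Def. 3.3 (iii) v2: the pull-back of functions between two Kummer levels `model (μ_{M_i}) → model (μ_{M_j})` of the
# ζ-twisted Tate tower, typed on abc-iut-L2-d2's level data `TateTowerTwist.Fn`

S. Mochizuki, *The étale theta function …*, Publ. RIMS **45** (2009) [MochizukiEtTh2009], §3 Def. 3.3 (iii) p.73 (pull-back of
meromorphic functions and log-divisors along `Z_∞^{(j)} → Z_∞^{(i)}`), §1 p.13 (`K_N ⊆ K_{N'}`) [cite: MochizukiEtTh2009, Def 3.3 (iii) p.73].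

CLASS (b) DESIGN MODEL, plumbing (abc-iut cell, layer L2, row R677/R722 «ζ-TWISTED KUMMER TOWER», piece (d) input; seat abc-iut-L1-t6
g4): abc-iut-L1-t6's `inflate` (`LogDivisorModelTateTowerKummerTwistInflate.lean`, p475183) re-typed on abc-iut-L2-d2's level functions
`TateTowerTwist.Fn A = A × Multiplicative (ℤ × ℤ)` (`LogDivisorModelTateTowerKummerTwistLevel.lean`, p475299) at `A = μ_{M_i} =
Multiplicative (ℤ/M_i)`, with `e = M_j / M_i`:
* `resFnLevel h : Fn (μ_{M_i}) →* Fn (μ_{M_j})`, `(ζ, ϖ_i^c U_i^k) ↦ (inflate ζ, ϖ_j^{e c} U_j^{e k})`; laws **`resFnLevel_refl`**, **`resFnLevel_trans`**,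
  **`resFnLevel_injective`** (the three `LogDivisorTower.resFn` laws); values on the generators `resFnLevel_zeta/unif/coordU`;
* compatibilities for the remaining `LogDivisorTower` function laws: `ordU_resFnLevel` (`U`-exponent scales by `e`), hence
  `resFnLevel_mem_const` / `resFnLevel_mem_intConst`; and **`divHom_resFnLevel`**: the skeleton divisor of the pulled-back function is the
  `e`-th power of the divisor (`= resDIV := powMonoidHom e`, as in abc-iut-w6-d058's abelian tower) — the law `divisor_resFn`.
(The `model`-dependent statements carry `[NeZero (M i)]` binders — `M i = (i+2)! ≠ 0`, `NeZero.of_pos (Nat.factorial_pos _)` — since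
`TateTowerTwist.model` asks `[Finite μ]`; no instance is declared here.)
HONEST LABEL: design-model plumbing, NOT the genuine tempered tower; nothing here bears on [IUTchIII] Cor. 3.12; typed ≠ proved.
-/

noncomputable section

namespace Literature.AnabelianGeometry.EtaleTheta

namespace TateTowerKummerTwist

open Function LogDivisorModel LogDivisorModel.TateTowerTwist

/-- The roots of unity of level `i`, multiplicatively: `μ_{M_i} = Multiplicative (ℤ/M_i)`. [cite: MochizukiEtTh2009, §1 p.13] -/
abbrev Mu (i : ℕ) : Type := Multiplicative (ZMod (M i))

/-- Inflation of roots of unity `μ_{M_i} →* μ_{M_j}` (`i ≤ j`), multiplicatively. [cite: MochizukiEtTh2009, §1 p.13] -/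
def inflateMul {i j : ℕ} (h : i ≤ j) : Mu i →* Mu j := AddMonoidHom.toMultiplicative (inflate h)

/-- `inflateMul` on exponents. [cite: MochizukiEtTh2009, §1 p.13] -/
@[simp] theorem toAdd_inflateMul {i j : ℕ} (h : i ≤ j) (z : Mu i) : (inflateMul h z).toAdd = inflate h z.toAdd := rfl

/-- **The pull-back of functions `model (μ_{M_i}) → model (μ_{M_j})`** along `Z_∞^{(j)} → Z_∞^{(i)}`:
`(ζ, ϖ_i^c U_i^k) ↦ (inflate ζ, ϖ_j^{e c} U_j^{e k})`, `e = M_j/M_i`. [cite: MochizukiEtTh2009, Def 3.3 (iii) p.73] -/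
def resFnLevel {i j : ℕ} (h : i ≤ j) : TateTowerTwist.Fn (Mu i) →* TateTowerTwist.Fn (Mu j) :=
  (inflateMul h).prodMap (AddMonoidHom.toMultiplicative (((M j / M i : ℕ) : ℤ) • AddMonoidHom.id (ℤ × ℤ)))

/-- `resFnLevel` on the root-of-unity factor. [cite: MochizukiEtTh2009, Def 3.3 (iii) p.73] -/
@[simp] theorem resFnLevel_fst {i j : ℕ} (h : i ≤ j) (f : TateTowerTwist.Fn (Mu i)) : (resFnLevel h f).1 = inflateMul h f.1 := rfl

/-- `resFnLevel` on the `ℤ²` exponents: multiplication by `e`. [cite: MochizukiEtTh2009, Def 3.3 (iii) p.73] -/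
@[simp] theorem toAdd_resFnLevel_snd {i j : ℕ} (h : i ≤ j) (f : TateTowerTwist.Fn (Mu i)) :
    (resFnLevel h f).2.toAdd = ((M j / M i : ℕ) : ℤ) • f.2.toAdd := rfl

/-- **Law `resFn_refl`.** [cite: MochizukiEtTh2009, Def 3.3 (iii) p.73] -/
theorem resFnLevel_refl (i : ℕ) (f : TateTowerTwist.Fn (Mu i)) : resFnLevel (le_refl i) f = f := by
  refine Prod.ext (Multiplicative.toAdd.injective ?_) (Multiplicative.toAdd.injective ?_)
  · rw [resFnLevel_fst, toAdd_inflateMul, inflate_refl]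
  · rw [toAdd_resFnLevel_snd, Nat.div_self (Nat.factorial_pos _), Nat.cast_one, one_smul]

/-- **Law `resFn_trans`.** [cite: MochizukiEtTh2009, Def 3.3 (iii) p.73] -/
theorem resFnLevel_trans {i j k : ℕ} (hij : i ≤ j) (hjk : j ≤ k) (f : TateTowerTwist.Fn (Mu i)) :
    resFnLevel (hij.trans hjk) f = resFnLevel hjk (resFnLevel hij f) := by
  refine Prod.ext (Multiplicative.toAdd.injective ?_) (Multiplicative.toAdd.injective ?_)
  · rw [resFnLevel_fst, resFnLevel_fst, toAdd_inflateMul, toAdd_inflateMul, resFnLevel_fst, toAdd_inflateMul,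
      inflate_trans hij hjk]
  · rw [toAdd_resFnLevel_snd, toAdd_resFnLevel_snd, toAdd_resFnLevel_snd, smul_smul, ← Nat.cast_mul, mul_comm (M k / M j),
      M_div_mul_M_div hij hjk]

/-- **Law `resFn_injective`.** [cite: MochizukiEtTh2009, Def 3.3 (iii) p.73] -/
theorem resFnLevel_injective {i j : ℕ} (h : i ≤ j) : Injective (resFnLevel h) := by
  intro f g hfg
  have h1 := congrArg (fun u : TateTowerTwist.Fn (Mu j) => u.1.toAdd) hfg
  have h2 := congrArg (fun u : TateTowerTwist.Fn (Mu j) => u.2.toAdd) hfg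
  simp only [resFnLevel_fst, toAdd_inflateMul, toAdd_resFnLevel_snd] at h1 h2
  have he : ((M j / M i : ℕ) : ℤ) ≠ 0 := by exact_mod_cast (M_div_pos h).ne'
  refine Prod.ext (Multiplicative.toAdd.injective (inflate_injective h h1)) (Multiplicative.toAdd.injective ?_)
  exact smul_right_injective (ℤ × ℤ) he h2

/-- A root of unity pulls back to the inflated root of unity. [cite: MochizukiEtTh2009, Def 3.3 (iii) p.73] -/
theorem resFnLevel_zeta {i j : ℕ} (h : i ≤ j) (ζ : Mu i) : resFnLevel h (zeta (Mu i) ζ) = zeta (Mu j) (inflateMul h ζ) :=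
  Prod.ext rfl ((AddMonoidHom.toMultiplicative (((M j / M i : ℕ) : ℤ) • AddMonoidHom.id (ℤ × ℤ))).map_one)

/-- `ϖ_i ↦ ϖ_j^e`. [cite: MochizukiEtTh2009, Def 3.3 (iii) p.73] -/
theorem resFnLevel_unif {i j : ℕ} (h : i ≤ j) : resFnLevel h (unif (Mu i)) = unif (Mu j) ^ (M j / M i) := by
  refine Prod.ext ?_ (Multiplicative.toAdd.injective ?_)
  · rw [resFnLevel_fst, Prod.pow_fst]
    change inflateMul h 1 = 1 ^ (M j / M i)
    rw [map_one, one_pow]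
  · rw [toAdd_resFnLevel_snd, Prod.pow_snd, toAdd_pow]
    change ((M j / M i : ℕ) : ℤ) • ((1 : ℤ), (0 : ℤ)) = (M j / M i) • ((1 : ℤ), (0 : ℤ))
    rw [natCast_zsmul]

/-- `U_i ↦ U_j^e`. [cite: MochizukiEtTh2009, Def 3.3 (iii) p.73] -/
theorem resFnLevel_coordU {i j : ℕ} (h : i ≤ j) : resFnLevel h (coordU (Mu i)) = coordU (Mu j) ^ (M j / M i) := by
  refine Prod.ext ?_ (Multiplicative.toAdd.injective ?_)
  · rw [resFnLevel_fst, Prod.pow_fst]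
    change inflateMul h 1 = 1 ^ (M j / M i)
    rw [map_one, one_pow]
  · rw [toAdd_resFnLevel_snd, Prod.pow_snd, toAdd_pow]
    change ((M j / M i : ℕ) : ℤ) • ((0 : ℤ), (1 : ℤ)) = (M j / M i) • ((0 : ℤ), (1 : ℤ))
    rw [natCast_zsmul]

/-- The `U`-exponent scales by `e` under pull-back. [cite: MochizukiEtTh2009, Def 3.3 (iii) p.73] -/
theorem toAdd_ordU_resFnLevel {i j : ℕ} (h : i ≤ j) (f : TateTowerTwist.Fn (Mu i)) :
    (ordU (Mu j) (resFnLevel h f)).toAdd = ((M j / M i : ℕ) : ℤ) * (ordU (Mu i) f).toAdd := by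
  rw [toAdd_ordU, toAdd_ordU, toAdd_resFnLevel_snd, Prod.smul_snd, smul_eq_mul]

/-- **Law `resFn_mem_const`**: constants pull back to constants. [cite: MochizukiEtTh2009, Def 3.3 (iii) p.73] -/
theorem resFnLevel_mem_const {i j : ℕ} [NeZero (M i)] [NeZero (M j)] (h : i ≤ j) {f : TateTowerTwist.Fn (Mu i)}
    (hf : f ∈ (TateTowerTwist.model (Mu i)).const) : resFnLevel h f ∈ (TateTowerTwist.model (Mu j)).const := by
  rw [mem_const_iff] at hf ⊢
  rw [toAdd_resFnLevel_snd, Prod.smul_snd, hf, smul_zero]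

/-- **Law `resFn_mem_intConst`**: integral constants pull back to integral constants. [cite: MochizukiEtTh2009, Def 3.3 (iii) p.73] -/
theorem resFnLevel_mem_intConst {i j : ℕ} [NeZero (M i)] [NeZero (M j)] (h : i ≤ j) {f : TateTowerTwist.Fn (Mu i)}
    (hf : f ∈ (TateTowerTwist.model (Mu i)).intConst) : resFnLevel h f ∈ (TateTowerTwist.model (Mu j)).intConst := by
  obtain ⟨h1, h2⟩ := hf
  refine ⟨?_, ?_⟩
  · rw [toAdd_resFnLevel_snd, Prod.smul_fst, smul_eq_mul]
    exact mul_nonneg (by exact_mod_cast (Nat.zero_le _)) h1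
  · rw [toAdd_resFnLevel_snd, Prod.smul_snd, h2, smul_zero]

/-- **Law `divisor_resFn`**: the skeleton divisor of the pulled-back function is the `e`-th power of the divisor (with
`resDIV := powMonoidHom e` as in the abelian tower). [cite: MochizukiEtTh2009, Def 3.3 (iii) p.73] -/
theorem divHom_resFnLevel {i j : ℕ} (h : i ≤ j) (f : TateTowerTwist.Fn (Mu i)) :
    TateTower.divHom (resFnLevel h f).2 = TateTower.divHom f.2 ^ (M j / M i) := by
  refine Multiplicative.toAdd.injective (funext fun x => ?_)
  rw [TateTower.toAdd_divHom, toAdd_resFnLevel_snd, Prod.smul_fst, Prod.smul_snd, toAdd_pow, Pi.smul_apply,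
    TateTower.toAdd_divHom, smul_eq_mul, smul_eq_mul, nsmul_eq_mul]
  push_cast
  ring

/-- The level-`j` divisor of the pulled-back function, in `model` terms. [cite: MochizukiEtTh2009, Def 3.3 (iii) p.73] -/
theorem divisor_resFnLevel {i j : ℕ} [NeZero (M i)] [NeZero (M j)] (h : i ≤ j) (f : (TateTowerTwist.model (Mu i)).logMero) :
    (TateTowerTwist.model (Mu j)).divisor ⟨resFnLevel h f.1, trivial⟩ = (TateTowerTwist.model (Mu i)).divisor f ^ (M j / M i) := by
  rw [divisor_apply, divisor_apply]
  exact divHom_resFnLevel h f.1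

end TateTowerKummerTwist

end Literature.AnabelianGeometry.EtaleTheta

end
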